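import Summits.Ventures.PercRepro.RankLevelSetExplicitLinArithB
import Summits.Ventures.PercRepro.RankLevelSetCircuitCountSparse
import Summits.Ventures.PercRepro.RankLevelSetExplicitCap
import Summits.Ventures.PercRepro.RankLevelSetDepCountMult
import Summits.Ventures.PercRepro.S1TriangleCount
import Summits.Ventures.PercRepro.S1FourCircuitCount
import Summits.Ventures.PercRepro.RankLevelSetPlaneSix
import Summits.Ventures.PercRepro.RankLevelSetCoreSparse
import Summits.Ventures.PercRepro.RankLevelSetLocalSparse

/-!
# PercRepro — THEOREM P⁗′: C-025 AT EVERY LEVEL `q ≥ 3` FOR EVERY `p ≥ Plin q`, WITH THE LINEAR-EXPONENT THRESHOLD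
`Plin q ≤ Tlin q + 1 = 20·q·2^q + 1` (p9, S4)

`proofs/SUBCLAIM-S4-p9.md` §S4.2⁗. THEOREM P⁗ (`RankLevelSetExplicitMult`, `Pmult q ≤ q·2^{⌈5q/4⌉+2} + 5q·2^{q+2} + 1`)
bounds the `k ≥ 5` circuit counts of the small class by `s_k ≤ C(d+k−1, k)`; LEMMA T_k
(`RankLevelSetCircuitCountSparse`: on the `e`-free core `s_k ≤ 2^{k−1}·C(d+k−2, k−1)`, the deletion / contraction
induction of the circuit count carried with the local-sparsity depth) takes one power of `d` off, and with the doubling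
lemma `2^j·C(m, j) ≤ C(2m, j)` the tail of the small class is `≤ C(2d+2q−2, 4)·C(2d+2q−6+n, q−4)` — degree `4` in `d`
like the Lemma T4 term. Everything else is THEOREM P⁗ verbatim (the multiplicity count with the closed-form weights,
local sparsity in the small-class weight index, the cap, Lemma T, Lemma T4, `poly_main_lin`), and the threshold is

* `c025_lin_all (q) (hq : 3 ≤ q) : ∀ M [M.Finite] p, Plin q ≤ p → RLS M p q`, `Plin 3 = 5`,
  `Plin (q+1) = max (Plin q) (Tlin (q+1)) + 1`, closed form `Plin_le_Tlin_succ : Plin q ≤ Tlin q + 1 = 20·q·2^q + 1`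
  (`q ≥ 4`): `Tlin 4 = 1 280`, `Tlin 5 = 3 200`, `Tlin 6 = 7 680`, `Tlin 7 = 17 920`, `Tlin 8 = 40 960`,
  `Tlin 9 = 92 160`, `Tlin 10 = 204 800`, `Tlin 20 = 419 430 400` — the shape `q·2^q` of the per-level ladders
  (`P(q) ≈ 1.4·(q+1)·2^{q−1}` at `q ≤ 10`, S4.1 (d)), a constant `≈ 28` above them; against THEOREM P‴'s
  `(q+2)·2^{2q+6}` and THEOREM P⁗'s `q·2^{⌈5q/4⌉+2} + 5q·2^{q+2}`.
Every fact used is a kernel theorem of the cell's tree or Mathlib. Axioms: standard.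
-/

open scoped Matroid

namespace PercRepro

namespace ThmN

open Set

variable {α : Type}

/-- **The `e`-free core at level `q ≥ 4`, bounded corank `q + 1 ≤ d ≤ q + 2^q`, rank `p ≥ Tlin q`** — the
multiplicity count with the cap and local sparsity, Lemma T, Lemma T4, LEMMA T_k with the doubling lemma for the tail,
`16·Σ_{j ≤ 2q+2^q} C(n, j) ≤ 2^n`, and `poly_main_lin`. -/
theorem c025_core_lin_bounded (q : ℕ) (hq : 4 ≤ q) (M : Matroid α) [M.Finite] (p d : ℕ)
    (hp : Explicit.Tlin q ≤ p) (hd1 : q + 1 ≤ d) (hd2 : d ≤ q + 2 ^ q)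
    (hR : M.eRank = (p : ℕ∞)) (hn : M.E.ncard = p + d)
    (hfree : ∀ e ∈ M.E, ∃ A ⊆ M.E \ {e}, e ∉ M.closure A ∧ e ∉ M.closure ((M.E \ {e}) \ A)) :
    RLS M p q := by
  classical
  obtain ⟨-, -, htail, -, -⟩ := Explicit.Tlin_bounds q hq
  obtain ⟨hy, -, hqy, -⟩ := Explicit.two_pow_facts q hq
  have hEcard : M.ground_finite.toFinset.card = p + d := by
    rw [← Set.ncard_eq_toFinset_card _ M.ground_finite]; exact hn
  -- the core is simple: every circuit has `≥ 3` elements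
  have hL : ∀ e ∈ M.E, ¬ M.IsLoop e := not_isLoop_of_free M hfree
  have hs : ∀ e ∈ M.E, ∀ f ∈ M.E, e ≠ f → M.eRk {e, f} = 2 := by
    intro e he f hf hef
    have h2 : (2 : ℕ∞) ≤ M.eRk {e, f} :=
      two_le_eRk_of_two_le_ncard_of_free M hfree (pair_subset he hf) (by rw [ncard_pair hef])
    have h3 : M.eRk {e, f} ≤ 2 := by
      have := M.eRk_le_encard {e, f}
      rwa [encard_pair hef] at this
    exact le_antisymm h3 h2
  have hcirc : ∀ C, M.IsCircuit C → 3 ≤ C.encard := three_le_encard_of_circuit M hL hs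
  have hd : M.E.encard = M.eRank + d := by
    rw [hR, ← M.ground_finite.cast_ncard_eq, hn]
    push_cast
    ring
  -- the nullity cap: every `X ⊆ E` has `|X| ≤ r(X) + d`
  have hcap : ∀ X ⊆ M.E, ∀ k : ℕ, M.eRk X ≤ k → X.ncard ≤ k + d := by
    intro X hX k hr
    have h1 := Matroid.encard_le_eRk_add_of_encard_eq hX hd
    have h2 : X.encard ≤ (k : ℕ∞) + d := h1.trans (by gcongr)
    have hfin : X.Finite := M.ground_finite.subset hX
    rw [← hfin.cast_ncard_eq] at h2
    exact_mod_cast h2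
  -- rank-`≤ q` sets have `≤ q + d` points (the cap); rank-`≤ q − 1` sets `≤ min (2^{q−1} − 1) (q − 1 + d)` points
  set f' : ℕ := min (2 ^ (q - 1) - 1) (q - 1 + d) with hf'def
  have hflat : ∀ X ⊆ M.E, M.eRk X ≤ q → X.ncard ≤ q + d := fun X hX hr => hcap X hX q hr
  have hflat' : ∀ X ⊆ M.E, M.eRk X ≤ ((q - 1 : ℕ) : ℕ∞) → X.ncard ≤ f' := by
    intro X hX hr
    refine le_min ?_ (hcap X hX (q - 1) hr)
    have := ncard_add_one_le_two_pow_of_eRk_le M hL hfree (q - 1) X hX hr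
    omega
  -- the weight index of the small class: `f' − q + 1 = μ := min (2^{q−1} − q) d`
  set μ : ℕ := min (2 ^ (q - 1) - q) d with hμdef
  have hμ : f' - q + 1 = μ := by
    rw [hf'def, hμdef]
    rcases le_total (2 ^ (q - 1) - 1) (q - 1 + d) with h | h
    · rw [min_eq_left h, min_eq_left (by omega)]; omega
    · rw [min_eq_right h, min_eq_right (by omega)]; omega
  have hμd : μ ≤ d := min_le_right _ _
  -- (U): the multiplicity count
  have hU1 := Matroid.topCount_le_ncard_compl (M := M) hR hd q
  have hsum := Matroid.ncard_eRk_eq_ncard_le_le_sum (M := M) q d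
  have hmul := fun m => Matroid.ncard_eRk_eq_ncard_eq_mul_le M q (q + d) f' (by omega) hcirc hflat hflat' hd m
  -- the circuit counts: Lemma T, Lemma T4, `s_k ≤ C(d+k−1, k)`
  have hC1 : ∀ L ⊆ M.E, M.eRk L = 2 → L.ncard ≤ 3 :=
    fun L hL' hr => ncard_le_three_of_eRk_two M hs hfree hL' hr
  have hs3 : 2 * {C | M.IsCircuit C ∧ C.ncard = 3}.ncard ≤ d * (d + 1) := S1.two_mul_ncard_triangles_le M hC1 hd
  have hC1' : ∀ L ⊆ M.E, M.eRk L ≤ 2 → L.ncard ≤ 3 := by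
    intro L hL' hr
    have := ncard_add_one_le_two_pow_of_eRk_le M hL hfree 2 L hL' hr
    omega
  have hC2 : ∀ P ⊆ M.E, M.eRk P ≤ 3 → P.ncard ≤ 6 :=
    fun P hP hr => ncard_le_six_of_eRk_le_three_of_free M hfree hP hr
  have hs4 : 3 * {C : Set α | M.IsCircuit C ∧ C.ncard = 4}.ncard ≤ d * (d + 1) * (d + 2) :=
    S1.three_mul_ncard_four_circuits_le M hC1' hC2 hd
  have hcs : ∀ k, 3 ≤ k → {C | M.IsCircuit C ∧ C.ncard = k}.ncard ≤ (d + k - 1).choose k := by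
    intro k hk
    have := Matroid.ncard_circuits_le_choose_of_encard M hd (k - 1)
    rw [show k - 1 + 1 = k by omega, show d + (k - 1) = d + k - 1 by omega] at this
    exact this
  -- LEMMA T_k on the core (depth `0`)
  have hsp : ∀ j : ℕ, ∀ X ⊆ M.E, M.eRk X ≤ j → X.ncard + 1 ≤ 2 ^ j :=
    fun j X hX hr => ncard_add_one_le_two_pow_of_eRk_le M hL hfree j X hX hr
  have hcsT : ∀ k, 1 ≤ k → {C | M.IsCircuit C ∧ C.ncard = k}.ncard ≤ 2 ^ (k - 1) * (d + k - 2).choose (k - 1) :=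
    fun k hk => Matroid.ncard_circuits_le_two_pow_mul_choose_of_free M hd hsp k hk
  -- the two pair sums, bounded
  set A : ℕ := ∑ k ∈ Finset.Icc 3 (q + 1), {C | M.IsCircuit C ∧ C.ncard = k}.ncard * M.E.ncard.choose (q + 1 - k)
    with hAdef
  set B : ℕ := ∑ k ∈ Finset.Icc 3 (q + 1), {C | M.IsCircuit C ∧ C.ncard = k}.ncard * ((q + 1) * d).choose (q + 1 - k)
    with hBdef
  have hA : 6 * A ≤ 3 * (d * (d + 1)) * (p + d).choose (q - 2) + 2 * (d * (d + 1) * (d + 2)) * (p + d).choose (q - 3) +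
      6 * ((2 * d + 2 * q - 2).choose 4 * (2 * d + 2 * q - 6 + (p + d)).choose (q - 4)) := by
    rw [hAdef, hn, Explicit.sum_Icc_three_split q hq, show q + 1 - 3 = q - 2 by omega, show q + 1 - 4 = q - 3 by omega]
    have h5 : ∑ k ∈ Finset.Icc 5 (q + 1), {C | M.IsCircuit C ∧ C.ncard = k}.ncard * (p + d).choose (q + 1 - k) ≤
        (2 * d + 2 * q - 2).choose 4 * (2 * d + 2 * q - 6 + (p + d)).choose (q - 4) := by
      refine (Finset.sum_le_sum (fun k hk => Nat.mul_le_mul_right _ (hcsT k (by rw [Finset.mem_Icc] at hk; omega)))).trans ?_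
      exact Explicit.tail_sum_le_sparse q d (p + d) hq
    have e3 : 6 * ({C | M.IsCircuit C ∧ C.ncard = 3}.ncard * (p + d).choose (q - 2)) ≤
        3 * (d * (d + 1)) * (p + d).choose (q - 2) := by
      calc 6 * ({C | M.IsCircuit C ∧ C.ncard = 3}.ncard * (p + d).choose (q - 2))
          = 3 * ((2 * {C | M.IsCircuit C ∧ C.ncard = 3}.ncard) * (p + d).choose (q - 2)) := by ring
        _ ≤ 3 * ((d * (d + 1)) * (p + d).choose (q - 2)) := Nat.mul_le_mul_left _ (Nat.mul_le_mul_right _ hs3)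
        _ = 3 * (d * (d + 1)) * (p + d).choose (q - 2) := by ring
    have e4 : 6 * ({C | M.IsCircuit C ∧ C.ncard = 4}.ncard * (p + d).choose (q - 3)) ≤
        2 * (d * (d + 1) * (d + 2)) * (p + d).choose (q - 3) := by
      calc 6 * ({C | M.IsCircuit C ∧ C.ncard = 4}.ncard * (p + d).choose (q - 3))
          = 2 * ((3 * {C | M.IsCircuit C ∧ C.ncard = 4}.ncard) * (p + d).choose (q - 3)) := by ring
        _ ≤ 2 * ((d * (d + 1) * (d + 2)) * (p + d).choose (q - 3)) := Nat.mul_le_mul_left _ (Nat.mul_le_mul_right _ hs4)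
        _ = 2 * (d * (d + 1) * (d + 2)) * (p + d).choose (q - 3) := by ring
    have e5 := Nat.mul_le_mul_left 6 h5
    omega
  have hB : B ≤ (d + q).choose 3 * (d + q - 3 + (q + 1) * d).choose (q - 2) := by
    rw [hBdef]
    refine (Finset.sum_le_sum (fun k hk => Nat.mul_le_mul_right _ (hcs k (by rw [Finset.mem_Icc] at hk; omega)))).trans ?_
    exact Explicit.circuit_sum_le_vandermonde q d ((q + 1) * d) (by omega)
  -- the level counts in `ℚ`, weighted by `1/(m − q)`
  have hlevel : ∀ m ∈ Finset.Icc (q + 1) d, ({X : Set α | X ⊆ M.E ∧ M.eRk X = q ∧ X.ncard = m}.ncard : ℚ) ≤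
      (((f' - q).choose (m - (q + 1)) : ℚ) * (A : ℚ) + ((q + d - (q + 1)).choose (m - (q + 1)) : ℚ) * (B : ℚ)) /
        ((m - q : ℕ) : ℚ) := by
    intro m hm
    rw [Finset.mem_Icc] at hm
    have hpos : (0 : ℚ) < ((m - q : ℕ) : ℚ) := by exact_mod_cast (by omega : 0 < m - q)
    rw [le_div_iff₀ hpos]
    have h := hmul m
    have h' : (((m - q) * {X : Set α | X ⊆ M.E ∧ M.eRk X = q ∧ X.ncard = m}.ncard : ℕ) : ℚ) ≤
        (((f' - q).choose (m - (q + 1)) * A + (q + d - (q + 1)).choose (m - (q + 1)) * B : ℕ) : ℚ) := by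
      exact_mod_cast h
    push_cast at h'
    linarith
  have hre : ∑ m ∈ Finset.Icc (q + 1) d,
      (((f' - q).choose (m - (q + 1)) : ℚ) * (A : ℚ) + ((q + d - (q + 1)).choose (m - (q + 1)) : ℚ) * (B : ℚ)) /
        ((m - q : ℕ) : ℚ) =
      ∑ j ∈ Finset.range (d - q),
      (((f' - q).choose j : ℚ) * (A : ℚ) + ((d - 1).choose j : ℚ) * (B : ℚ)) / ((j : ℚ) + 1) := by
    rw [show Finset.Icc (q + 1) d = Finset.image (fun j => q + 1 + j) (Finset.range (d - q)) from ?_]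
    · rw [Finset.sum_image (fun a _ b _ h => by omega)]
      apply Finset.sum_congr rfl
      intro j _
      rw [show q + 1 + j - (q + 1) = j by omega, show q + 1 + j - q = j + 1 by omega,
        show q + d - (q + 1) = d - 1 by omega]
      push_cast
      ring
    · ext m
      rw [Finset.mem_Icc, Finset.mem_image]
      constructor
      · intro hm
        exact ⟨m - (q + 1), by rw [Finset.mem_range]; omega, by omega⟩
      · rintro ⟨j, hj, rfl⟩
        rw [Finset.mem_range] at hj
        omega
  -- the two weights
  set Ws : ℚ := ∑ j ∈ Finset.range (d - q), (((f' - q).choose j : ℕ) : ℚ) / ((j : ℚ) + 1) with hWsdef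
  set Wb : ℚ := ∑ j ∈ Finset.range (d - q), (((d - 1).choose j : ℕ) : ℚ) / ((j : ℚ) + 1) with hWbdef
  have hUq : (Matroid.topCount M p q : ℚ) ≤ ((p + d).choose q : ℚ) + (Ws * (A : ℚ) + Wb * (B : ℚ)) := by
    have h1 : (Matroid.topCount M p q : ℚ) ≤ ((p + d).choose q : ℚ) +
        ∑ m ∈ Finset.Icc (q + 1) d, ({X : Set α | X ⊆ M.E ∧ M.eRk X = q ∧ X.ncard = m}.ncard : ℚ) := by
      have := hU1.trans hsum
      rw [hn] at this
      exact_mod_cast this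
    have h2 : ∑ m ∈ Finset.Icc (q + 1) d, ({X : Set α | X ⊆ M.E ∧ M.eRk X = q ∧ X.ncard = m}.ncard : ℚ) ≤
        Ws * (A : ℚ) + Wb * (B : ℚ) := by
      rw [hWsdef, hWbdef, Finset.sum_mul, Finset.sum_mul, ← Finset.sum_add_distrib]
      refine (Finset.sum_le_sum hlevel).trans (hre.le.trans ?_)
      apply le_of_eq
      apply Finset.sum_congr rfl
      intro j _
      field_simp
    linarith
  -- the weight bounds: `Ws·μ ≤ 2^d`, `Wb·d ≤ 2^d`
  have hWs : Ws * (μ : ℚ) ≤ 2 ^ d := by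
    have h1 := Explicit.sum_range_choose_div_succ_le (f' - q) (d - q)
    rw [← hWsdef] at h1
    have hμq : ((f' - q : ℕ) : ℚ) + 1 = (μ : ℚ) := by exact_mod_cast hμ
    have hμpos : (0 : ℚ) < (μ : ℚ) := by
      have : 1 ≤ μ := by omega
      exact_mod_cast this
    rw [hμq, le_div_iff₀ hμpos] at h1
    have h2 : (2 : ℚ) ^ (f' - q + 1) ≤ 2 ^ d := pow_le_pow_right₀ (by norm_num) (by omega)
    linarith
  have hWb : Wb * (d : ℚ) ≤ 2 ^ d := by
    have h1 := Explicit.sum_range_choose_div_succ_le (d - 1) (d - q)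
    rw [← hWbdef, show d - 1 + 1 = d by omega] at h1
    have hdq : ((d - 1 : ℕ) : ℚ) + 1 = (d : ℚ) := by
      have : d - 1 + 1 = d := by omega
      exact_mod_cast this
    have hdpos : (0 : ℚ) < (d : ℚ) := by exact_mod_cast (show 0 < d by omega)
    rw [hdq, le_div_iff₀ hdpos] at h1
    linarith
  -- (Y)
  have hY := Matroid.two_pow_le_midCount_add (M := M) p q hR
  have hAc : {X : Set α | X ⊆ M.E ∧ M.eRk X ≤ q}.ncard ≤ ∑ j ∈ Finset.range (q + d + 1), (p + d).choose j := by
    calc {X : Set α | X ⊆ M.E ∧ M.eRk X ≤ q}.ncard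
        ≤ {X : Set α | X ⊆ (M.ground_finite.toFinset : Set α) ∧ X.ncard ≤ q + d}.ncard := by
          apply ncard_le_ncard
          · intro X hX
            exact ⟨by rw [Set.Finite.coe_toFinset]; exact hX.1, hflat X hX.1 hX.2⟩
          · exact (Finset.finite_toSet _).finite_subsets.subset (fun X hX => hX.1)
      _ ≤ ∑ j ∈ Finset.range (q + d + 1), M.ground_finite.toFinset.card.choose j :=
          ncard_subsets_ncard_le _ (q + d)
      _ = ∑ j ∈ Finset.range (q + d + 1), (p + d).choose j := by rw [hEcard]
  have hBc := Matroid.ncard_spanning_le (M := M) hd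
  rw [hEcard] at hY hBc
  -- the tail with `K = 2q + 2^q`
  have hT : 16 * ∑ j ∈ Finset.range (2 * q + 2 ^ q + 1), (p + d).choose j ≤ 2 ^ (p + d) :=
    Explicit.sixteen_mul_sum_range_choose_le (2 * q + 2 ^ q) (p + d) (by omega)
  have hA' : ∑ j ∈ Finset.range (q + d + 1), (p + d).choose j ≤
      ∑ j ∈ Finset.range (2 * q + 2 ^ q + 1), (p + d).choose j :=
    Finset.sum_le_sum_of_subset_of_nonneg (Finset.range_mono (by omega)) (fun _ _ _ => Nat.zero_le _)
  have hB' : ∑ j ∈ Finset.range (d + 1), (p + d).choose j ≤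
      ∑ j ∈ Finset.range (2 * q + 2 ^ q + 1), (p + d).choose j :=
    Finset.sum_le_sum_of_subset_of_nonneg (Finset.range_mono (by omega)) (fun _ _ _ => Nat.zero_le _)
  have hAB : 8 * ({X : Set α | X ⊆ M.E ∧ M.eRk X ≤ q}.ncard +
      {X : Set α | X ⊆ M.E ∧ M.eRk X = M.eRank}.ncard) ≤ 2 ^ (p + d) := by
    have h1 := hAc.trans hA'
    have h2 := hBc.trans hB'
    omega
  -- (Φ) and the polynomial inequality
  have hΦ := phiK_le_two_pow_div p q
  rw [Nat.choose_symm_add] at hΦ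
  have hpolyq := Explicit.poly_main_lin q d p μ hq hd1 hd2 hp rfl A B Ws Wb hWs hWb hA hB
  rw [add_assoc] at hpolyq
  -- assemble in `ℚ`
  rw [RLS_iff]
  have hYq : (2 : ℚ) ^ (p + d) ≤ (Matroid.midCount M p q : ℚ) +
      ({X : Set α | X ⊆ M.E ∧ M.eRk X ≤ q}.ncard : ℚ) +
      ({X : Set α | X ⊆ M.E ∧ M.eRk X = M.eRank}.ncard : ℚ) := by exact_mod_cast hY
  have hABq : 8 * (({X : Set α | X ⊆ M.E ∧ M.eRk X ≤ q}.ncard : ℚ) +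
      ({X : Set α | X ⊆ M.E ∧ M.eRk X = M.eRank}.ncard : ℚ)) ≤ 2 ^ (p + d) := by exact_mod_cast hAB
  have hU0 : (0 : ℚ) ≤ (Matroid.topCount M p q : ℚ) := Nat.cast_nonneg _
  exact level_arith (p := p) (d := d) (n := p + d) (q := q) rfl (by omega) hΦ hU0 hUq hYq hABq hpolyq

/-- **The level step with the linear-exponent threshold**: level `q` for all `p ≥ P` and `P ≥ Tlin (q+1)` give
level `q + 1` for all `p ≥ P + 1` (`rls_succ_large` with `D = q + 1`; the core is `c025_core_lin_bounded` /
`c025_core_explicit_large'` at level `q + 1`). -/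
theorem c025_succ_lin (q : ℕ) (hq : 3 ≤ q) (P : ℕ) (hP : Explicit.Tlin (q + 1) ≤ P)
    (hprev : ∀ (M : Matroid α) [M.Finite] (p : ℕ), P ≤ p → q + 2 ≤ p → RLS M p q) :
    ∀ (M : Matroid α) [M.Finite] (p : ℕ), P + 1 ≤ p → RLS M p (q + 1) := by
  intro M _ p hp
  obtain ⟨hN₁, -, -, -, hq3⟩ := Explicit.Tlin_bounds (q + 1) (by omega)
  refine rls_succ_large (α := α) q (q + 1) P hprev ?_ ?_ M p hp (by omega)
  · -- corank `≤ q + 1`: `U = ∅` or Theorem M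
    intro M' _ p' _ hn _
    rcases Nat.lt_or_ge M'.E.ncard (p' + (q + 1)) with h | h
    · exact RLS_of_ncard_lt M' h
    · exact RLS_of_ncard_eq M' (by omega)
  · -- the core at level `q + 1`
    intro M' _ p' hP' hR hbig _ hfree
    rcases Nat.lt_or_ge M'.E.ncard (p' + (q + 1) + 2 ^ (q + 1) + 1) with h | h
    · exact c025_core_lin_bounded (q + 1) (by omega) M' p' (M'.E.ncard - p') (hP.trans hP')
        (by omega) (by omega) hR (by omega) hfree
    · exact c025_core_explicit_large' (q + 1) (by omega) M' p' (by omega) hR (by omega) hfree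

/-- **THE LINEAR-EXPONENT THRESHOLD SEQUENCE** `Plin`: `Plin 3 = 5` (the `q = 3` row), and
`Plin (q+1) = max (Plin q) (Tlin (q+1)) + 1` for `q ≥ 3`. -/
def Plin : ℕ → ℕ
  | 0 => 5
  | 1 => 5
  | 2 => 5
  | 3 => 5
  | q + 4 => max (Plin (q + 3)) (Explicit.Tlin (q + 4)) + 1

/-- The recursion of `Plin` at `q ≥ 3`. -/
theorem Plin_succ (q : ℕ) (hq : 3 ≤ q) : Plin (q + 1) = max (Plin q) (Explicit.Tlin (q + 1)) + 1 := by
  obtain ⟨k, rfl⟩ : ∃ k, q = k + 3 := ⟨q - 3, by omega⟩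
  rfl

/-- **THEOREM P⁗′ — C-025 AT EVERY LEVEL `q ≥ 3` FOR EVERY FINITE MATROID AND EVERY `p ≥ Plin q`**, with the
threshold `Plin` of order `q·2^q` (induction on `q` from the `q = 3` row `SevenThree.c025_three_all` through
`c025_succ_lin`). -/
theorem c025_lin_all (q : ℕ) (hq : 3 ≤ q) :
    ∀ (M : Matroid α) [M.Finite] (p : ℕ), Plin q ≤ p → RLS M p q := by
  induction q, hq using Nat.le_induction with
  | base =>
    intro M _ p hp
    exact SevenThree.c025_three_all M p hp
  | succ q hq ih =>
    intro M _ p hp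
    rw [Plin_succ q hq] at hp
    refine c025_succ_lin q hq (max (Plin q) (Explicit.Tlin (q + 1))) (le_max_right _ _) ?_ M p hp
    intro M' _ p' hP' _
    exact ih M' p' ((le_max_left _ _).trans hP')

/-- THEOREM P⁗′ in the literal `C025` body at `(p, q)`. -/
theorem c025_lin_all' (q : ℕ) (hq : 3 ≤ q) (M : Matroid α) [M.Finite] (p : ℕ) (hp : Plin q ≤ p) :
    phiK p q * ({A : Set α | A ⊆ M.E ∧ M.eRk A = (p : ℕ∞) ∧ M.eRk (M.E \ A) = (q : ℕ∞)}.ncard : ℚ) ≤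
      ({A : Set α | A ⊆ M.E ∧ (q : ℕ∞) < M.eRk A ∧ M.eRk A < (p : ℕ∞)}.ncard : ℚ) :=
  c025_lin_all q hq M p hp

/-- **THE CLOSED FORM**: `Plin q ≤ Tlin q + 1 = 20·q·2^q + 1` for every `q ≥ 4`. -/
theorem Plin_le_Tlin_succ (q : ℕ) (hq : 4 ≤ q) : Plin q ≤ Explicit.Tlin q + 1 := by
  induction q, hq using Nat.le_induction with
  | base =>
    show max (Plin 3) (Explicit.Tlin 4) + 1 ≤ Explicit.Tlin 4 + 1
    have : Plin 3 ≤ Explicit.Tlin 4 := by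
      show 5 ≤ Explicit.Tlin 4
      unfold Explicit.Tlin; norm_num
    omega
  | succ q hq ih =>
    rw [Plin_succ q (by omega)]
    have h := Explicit.Tlin_succ_le q
    have : max (Plin q) (Explicit.Tlin (q + 1)) ≤ Explicit.Tlin (q + 1) := max_le (by omega) le_rfl
    omega

/-- **THE ROWS OF S4 (`q ≥ 7`) WITH THE LINEAR-EXPONENT THRESHOLD**: C-025 at level `q` for every
`p ≥ 20·q·2^q + 1`. -/
theorem c025_lin_seven_up (q : ℕ) (hq : 7 ≤ q) (M : Matroid α) [M.Finite] (p : ℕ)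
    (hp : 20 * q * 2 ^ q + 1 ≤ p) : RLS M p q :=
  c025_lin_all q (by omega) M p ((Plin_le_Tlin_succ q (by omega)).trans hp)

/-- Level `7` for `p ≥ 17 921` by THEOREM P⁗′ (weaker than the ladder `651`; recorded for the comparison with
THEOREM P‴'s `9 437 185` and THEOREM P⁗'s `32 257`). -/
theorem c025_lin_seven (M : Matroid α) [M.Finite] (p : ℕ) (hp : 17921 ≤ p) : RLS M p 7 :=
  c025_lin_seven_up 7 le_rfl M p (by norm_num; omega)

end ThmN

end PercRepro
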